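import Mathlib
import Literature.Geometry.Symplectic.JHolomorphicFlatUniqueContinuation
import HarnessLib

/-!
# Unique continuation for flat `J`-holomorphic discs: the discharge (Carleman's method)

This file PROVES the named fact
`Literature.Geometry.Symplectic.jHolomorphicFlat_uniqueContinuation_const`
(`JHolomorphicFlatUniqueContinuation.lean`; D. McDuff, JDG 34 (1991), Lemma 2.3 with (2.3.1)):
a `C^∞` map `u` from a disc into an open set `T ⊆ ℝ⁴` carrying a smooth field of complex structures
`Jc`, which is `Jc`-holomorphic in the flat sense `Du(z)(iζ) = Jc(u z)(Du(z) ζ)` and constant near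
one point of the disc, is constant on the disc:

* `jHolomorphicFlat_uniqueContinuation_const_holds : jHolomorphicFlat_uniqueContinuation_const`.

McDuff's printed proof reduces (in coordinates, (2.3.1)) to a differential inequality and invokes
Aronszajn's strong unique continuation theorem. Neither Aronszajn's theorem nor the similarity
principle for *systems* is in Mathlib or in the tree (the tree's similarity principle,
`Literature/Analysis/Complex/SimilarityPrinciple.lean`, is scalar, while `u - u z₀` is
`ℝ⁴ ≅ ℂ²`-valued and the zeroth-order term couples the components). Since only WEAK unique
continuation (from an open set) is needed, we give instead a self-contained proof by
T. Carleman's original weighted-`L²` method for first-order elliptic systems in two variables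
(Carleman 1939; the weight identity is the real form of L. Hörmander's
`‖P g‖² = ‖P* g‖² + 2τ ∫ φ_{z z̄} |g|²` for `P = e^{τφ} ∂̄ e^{-τφ}`), which handles systems
verbatim. Everything below is proved; there are no new named facts.

## Contents (namespace `Literature.Geometry.Symplectic.FlatUniqueContinuation`)

Let `V` be a real inner product space and `J : V →L[ℝ] V` with `J ∘ J = -1`; put
`B a b = ⟪a, b⟫ + ⟪J a, J b⟫` (`Bf`, a `J`-invariant symmetric form for which `J` is skew),
`N a = B a a ≥ ‖a‖²` (`Nf`), `∂ₓ f = Df(·) 1`, `∂ᵧ f = Df(·) i` (`dX`, `dY`), `Δ = ∂ₓ∂ₓ + ∂ᵧ∂ᵧ`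
(`lap`) and `D_J f = ∂ₓ f + J ∂ᵧ f` (`Dop`; this is `2 ∂̄_J f`).

1. `Nf_carleman_identity` — the pointwise algebra: with `g = e^{τφ} f`,
   `N(e^{τφ} D_J f) = N(a⁺ - J b⁺) - 4τ (φₓ B(gₓ, g) + φ_y B(g_y, g)) + 4 B(gₓ, J g_y)`.
2. `integral_dphi_Bf`, `integral_Bf_dX_J_dY` — the two integrations by parts on `ℂ`
   (`∫ φₓ B(gₓ, g) = -½ ∫ φₓₓ N(g)`; `∫ B(gₓ, J g_y) = 0`), from Mathlib's
   `integral_bilinear_hasLineDerivAt_right_eq_neg_left_of_integrable`.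
3. `carleman_estimate` — `2τ ∫ Δφ e^{2τφ} N(f) ≤ ∫ e^{2τφ} N(D_J f)` for `f ∈ C²_c`, `φ ∈ C²`.
4. `eq_zero_of_carleman` — if `N(D_J f) ≤ a ‖f‖² + E` with an error `E` living in `{φ ≤ l}`
   and `Δφ ≥ μ > 0` on the support of `f`, then `f = 0` on `{φ > l}` (`τ → ∞`).
5. `weight`, `lap_weight` — the weight `φ = (κ + ‖z - b‖²)⁻¹`, `Δφ = 4(‖z-b‖² - κ) φ³`, its
   level discs; `contDiff_smul_of_tsupport_subset` etc. — cut-off calculus.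
6. `local_step` — if `‖D_J w‖ ≤ M ‖w‖` on an open `U`, `w = 0` on `ball z' ρ`, `p` on the
   boundary circle and `closedBall p (2δ) ⊆ U`, then `w = 0` on `ball p (stepRadius ρ δ)`
   (weight centred at the interior point at distance `σ = min ρ (δ/8)` from `p`, `κ = σ²/2`).
7. `radial_propagation`, `eq_zero_on_ball` — continuity in the radius and a clopen argument:
   **weak unique continuation on a disc** for `C²` solutions of `‖∂ₓw + J∂ᵧw‖ ≤ M ‖w‖`.
8. The discharge: `w = u - u z₀`, `J = Jc (u z₀)` gives `D_J w = J (Jc(u) - J) ∂ₓu`, and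
   `‖Jc (u z) - Jc (u z₀)‖ ≤ L ‖u z - u z₀‖` on compact sub-discs
   (`exists_norm_sub_le_mul_of_contDiffOn`), so 7 applies on every `ball c r'`, `r' < r`.

Design: real inner-product-space valued maps and the averaged form `B` avoid choosing complex
coordinates adapted to `J`; only `C²` regularity of `u` and `C¹` of `Jc` are used.
Deliberately NOT here: strong unique continuation (infinite-order zeros), Aronszajn's theorem,
the similarity principle for systems, anything about two curves.

## References

* D. McDuff, *The local behaviour of holomorphic curves in almost complex 4-manifolds*,
  J. Differential Geom. 34 (1991) 143–164, Lemma 2.3, (2.3.1). [McDuff1991LocalBehaviour]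
* T. Carleman, *Sur un problème d'unicité pour les systèmes d'équations aux dérivées partielles à
  deux variables indépendantes*, Ark. Mat. Astr. Fys. 26B (1939), no. 17, 1–9. [Carleman1939Unicite]
* D. McDuff, D. Salamon, *J-holomorphic curves and symplectic topology*, 2nd ed. (2012), §2.3.
  [McDuffSalamon2012]
-/

noncomputable section

open scoped InnerProductSpace
open Set Filter Topology MeasureTheory Metric

namespace Literature.Geometry.Symplectic

namespace FlatUniqueContinuation

variable {V : Type*} [NormedAddCommGroup V] [InnerProductSpace ℝ V]

/-- The `J`-symmetrised inner product `B a b = ⟪a, b⟫ + ⟪J a, J b⟫`, as a continuous bilinear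
form. [folklore] -/
def Bf (J : V →L[ℝ] V) : V →L[ℝ] V →L[ℝ] ℝ :=
  innerSL ℝ + (((innerSL ℝ (E := V)).comp J).flip.comp J).flip

/-- Evaluation of `Bf`. [folklore] -/
@[simp] theorem Bf_apply (J : V →L[ℝ] V) (a b : V) :
    Bf J a b = ⟪a, b⟫_ℝ + ⟪J a, J b⟫_ℝ := by
  simp [Bf, innerSL_apply_apply]; rfl

/-- The `J`-invariant squared norm `N a = ‖a‖² + ‖J a‖²`. [folklore] -/
def Nf (J : V →L[ℝ] V) (a : V) : ℝ := Bf J a a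

/-- `N a = ‖a‖² + ‖J a‖²`. [folklore] -/
theorem Nf_eq (J : V →L[ℝ] V) (a : V) : Nf J a = ‖a‖ ^ 2 + ‖J a‖ ^ 2 := by
  simp [Nf, Bf_apply]

/-- `N ≥ 0`. [folklore] -/
theorem Nf_nonneg (J : V →L[ℝ] V) (a : V) : 0 ≤ Nf J a := by
  rw [Nf_eq]; positivity

/-- `‖a‖² ≤ N a`. [folklore] -/
theorem sq_norm_le_Nf (J : V →L[ℝ] V) (a : V) : ‖a‖ ^ 2 ≤ Nf J a := by
  rw [Nf_eq]; nlinarith [sq_nonneg ‖J a‖]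

/-- `N a ≤ (1 + ‖J‖²) ‖a‖²`. [folklore] -/
theorem Nf_le (J : V →L[ℝ] V) (a : V) : Nf J a ≤ (1 + ‖J‖ ^ 2) * ‖a‖ ^ 2 := by
  rw [Nf_eq]
  have h := J.le_opNorm a
  have h0 : 0 ≤ ‖J‖ := norm_nonneg _
  nlinarith [norm_nonneg (J a), norm_nonneg a, mul_nonneg h0 (norm_nonneg a)]

/-- `N a = 0 ↔ a = 0`. [folklore] -/
theorem Nf_eq_zero_iff (J : V →L[ℝ] V) (a : V) : Nf J a = 0 ↔ a = 0 := by
  constructor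
  · intro h
    have h1 := sq_norm_le_Nf J a
    rw [h] at h1
    have : ‖a‖ ^ 2 = 0 := le_antisymm h1 (sq_nonneg _)
    simpa using this
  · rintro rfl; simp [Nf_eq]

/-- `B` is symmetric. [folklore] -/
theorem Bf_comm (J : V →L[ℝ] V) (a b : V) : Bf J a b = Bf J b a := by
  simp [Bf_apply, real_inner_comm]

section skew

variable {J : V →L[ℝ] V} (hJ : ∀ v, J (J v) = -v)
include hJ

/-- `B` is `J`-invariant when `J² = -1`. [folklore] -/
theorem Bf_J_J (a b : V) : Bf J (J a) (J b) = Bf J a b := by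
  simp [Bf_apply, hJ, add_comm]

/-- `J` is `B`-skew when `J² = -1`. [folklore] -/
theorem Bf_J_left (a b : V) : Bf J (J a) b = -Bf J a (J b) := by
  simp [Bf_apply, hJ]

/-- `B(a, J a) = 0` when `J² = -1`. [folklore] -/
theorem Bf_self_J (a : V) : Bf J a (J a) = 0 := by
  have h1 := Bf_J_left hJ a a
  have h2 := Bf_comm J (J a) a
  linarith

/-- `N (J a) = N a` when `J² = -1`. [folklore] -/
theorem Nf_J (a : V) : Nf J (J a) = Nf J a := Bf_J_J hJ a a

/-- The pointwise algebraic identity behind the Carleman estimate for `∂ₓ + J ∂ᵧ`: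
with `a⁻ = gx - (τ φx) g`, `b⁻ = gy - (τ φy) g`, `a⁺ = gx + (τ φx) g`, `b⁺ = gy + (τ φy) g`,
`N (a⁻ + J b⁻) = N (a⁺ - J b⁺) - 4 τ (φx B(gx, g) + φy B(gy, g)) + 4 B(gx, J gy)`. [folklore] -/
theorem Nf_carleman_identity (g gx gy : V) (τ φx φy : ℝ) :
    Nf J ((gx - (τ * φx) • g) + J (gy - (τ * φy) • g)) =
      Nf J ((gx + (τ * φx) • g) - J (gy + (τ * φy) • g))
        - 4 * τ * (φx * Bf J gx g + φy * Bf J gy g) + 4 * Bf J gx (J gy) := by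
  have e1 : Bf J g gx = Bf J gx g := Bf_comm J _ _
  have e2 : Bf J g gy = Bf J gy g := Bf_comm J _ _
  have e3 : Bf J (J gy) gx = Bf J gx (J gy) := Bf_comm J _ _
  have e4 : Bf J (J gy) (J gy) = Bf J gy gy := Bf_J_J hJ _ _
  have e5 : Bf J (J g) (J g) = Bf J g g := Bf_J_J hJ _ _
  have e6 : Bf J (J gy) (J g) = Bf J gy g := Bf_J_J hJ _ _
  have e7 : Bf J (J g) (J gy) = Bf J gy g := by rw [Bf_J_J hJ]; exact e2
  have e8 : Bf J g (J g) = 0 := Bf_self_J hJ _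
  have e9 : Bf J (J g) g = 0 := by rw [Bf_comm]; exact e8
  have e10 : Bf J gx (J g) = - Bf J g (J gx) := by
    rw [Bf_comm J gx, Bf_J_left hJ]
  have e11 : Bf J (J g) gx = - Bf J g (J gx) := Bf_J_left hJ _ _
  have e12 : Bf J g (J gy) = - Bf J gy (J g) := by
    rw [Bf_comm J g, Bf_J_left hJ]
  have e13 : Bf J (J gy) g = - Bf J gy (J g) := Bf_J_left hJ _ _
  simp only [Nf, map_add, map_sub, map_smul, add_apply,
    sub_apply, FunLike.coe_smul, Pi.smul_apply, smul_eq_mul]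
  simp only [e1, e3, e4, e5, e6, e7, e8, e9, e10, e11, e12, e13]
  ring

end skew

variable {W : Type*} [NormedAddCommGroup W] [NormedSpace ℝ W]

/-! ### Partial derivatives on `ℂ` and the operator `∂ₓ + J ∂ᵧ` -/

/-- `∂ₓ f z = Df(z) 1`. [folklore] -/
def dX (f : ℂ → W) (z : ℂ) : W := fderiv ℝ f z 1

/-- `∂ᵧ f z = Df(z) i`. [folklore] -/
def dY (f : ℂ → W) (z : ℂ) : W := fderiv ℝ f z Complex.I

/-- The flat Laplacian `∂ₓ∂ₓφ + ∂ᵧ∂ᵧφ` of a real function on `ℂ`. [folklore] -/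
def lap (φ : ℂ → ℝ) (z : ℂ) : ℝ := dX (dX φ) z + dY (dY φ) z

/-- The Cauchy–Riemann type operator `D_J f = ∂ₓ f + J ∂ᵧ f` (`= 2 ∂̄_J f`). [folklore] -/
def Dop (J : V →L[ℝ] V) (f : ℂ → V) (z : ℂ) : V := dX f z + J (dY f z)

/-- `N (c • a) = c² N a`. [folklore] -/
theorem Nf_smul (J : V →L[ℝ] V) (c : ℝ) (a : V) : Nf J (c • a) = c ^ 2 * Nf J a := by
  simp only [Nf_eq, map_smul, norm_smul, Real.norm_eq_abs, mul_pow, sq_abs]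
  ring

/-- Continuity of `z ↦ B(u z, v z)`. [folklore] -/
theorem continuous_Bf (J : V →L[ℝ] V) {X : Type*} [TopologicalSpace X] {u v : X → V}
    (hu : Continuous u) (hv : Continuous v) : Continuous fun x => Bf J (u x) (v x) :=
  (Bf J).continuous₂.comp (hu.prodMk hv)

/-- Continuity of `z ↦ N(u z)`. [folklore] -/
theorem continuous_Nf (J : V →L[ℝ] V) {X : Type*} [TopologicalSpace X] {u : X → V}
    (hu : Continuous u) : Continuous fun x => Nf J (u x) :=
  continuous_Bf J hu hu

/-- `C²` functions have differentiable partial derivatives. [folklore] -/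
theorem contDiff_one_dX {f : ℂ → W} (hf : ContDiff ℝ 2 f) : ContDiff ℝ 1 (dX f) := by
  have h := hf.fderiv_right (m := 1) (by norm_num)
  exact h.clm_apply contDiff_const

/-- `C²` functions have `C¹` partial derivatives (along `i`). [folklore] -/
theorem contDiff_one_dY {f : ℂ → W} (hf : ContDiff ℝ 2 f) : ContDiff ℝ 1 (dY f) := by
  have h := hf.fderiv_right (m := 1) (by norm_num)
  exact h.clm_apply contDiff_const

/-- Continuity of `∂ₓ f` for `f ∈ C²`. [folklore] -/
theorem continuous_dX {f : ℂ → W} (hf : ContDiff ℝ 2 f) : Continuous (dX f) :=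
  (contDiff_one_dX hf).continuous

/-- Continuity of `∂ᵧ f` for `f ∈ C²`. [folklore] -/
theorem continuous_dY {f : ℂ → W} (hf : ContDiff ℝ 2 f) : Continuous (dY f) :=
  (contDiff_one_dY hf).continuous

/-- `∂ₓ f = 0` off the topological support of `f`. [folklore] -/
theorem dX_eq_zero_of_notMem {f : ℂ → W} {z : ℂ} (hz : z ∉ tsupport f) : dX f z = 0 := by
  simp [dX, fderiv_of_notMem_tsupport ℝ hz]

/-- `∂ᵧ f = 0` off the topological support of `f`. [folklore] -/
theorem dY_eq_zero_of_notMem {f : ℂ → W} {z : ℂ} (hz : z ∉ tsupport f) : dY f z = 0 := by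
  simp [dY, fderiv_of_notMem_tsupport ℝ hz]

/-- Line derivative of `∂ᵥ f` along `w` is the second derivative `D²f z w v`. [folklore] -/
theorem hasLineDerivAt_fderiv_apply {f : ℂ → W} (hf : ContDiff ℝ 2 f) (z v w : ℂ) :
    HasLineDerivAt ℝ (fun y => fderiv ℝ f y v) (fderiv ℝ (fderiv ℝ f) z w v) z w := by
  have h1 : ContDiff ℝ 1 (fderiv ℝ f) := hf.fderiv_right (m := 1) (by norm_num)
  have h2 : HasFDerivAt (fderiv ℝ f) (fderiv ℝ (fderiv ℝ f) z) z :=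
    (h1.differentiable one_ne_zero z).hasFDerivAt
  have h3 := ((ContinuousLinearMap.apply ℝ W v).hasFDerivAt.comp z h2).hasLineDerivAt w
  refine HasDerivAt.congr_deriv h3 ?_
  simp

/-- Symmetry of second derivatives of `C²` functions. [folklore] -/
theorem fderiv_fderiv_symm {f : ℂ → W} (hf : ContDiff ℝ 2 f) (z v w : ℂ) :
    fderiv ℝ (fderiv ℝ f) z v w = fderiv ℝ (fderiv ℝ f) z w v :=
  (hf.contDiffAt.isSymmSndFDerivAt (by simp)) v w

/-- `∂ₓ∂ᵧ f = ∂ᵧ∂ₓ f` for `f ∈ C²`. [folklore] -/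
theorem dX_dY_eq_dY_dX {f : ℂ → W} (hf : ContDiff ℝ 2 f) (z : ℂ) : dX (dY f) z = dY (dX f) z := by
  have h1 := (hasLineDerivAt_fderiv_apply hf z Complex.I 1).lineDeriv
  have h2 := (hasLineDerivAt_fderiv_apply hf z 1 Complex.I).lineDeriv
  have e1 : dX (dY f) z = fderiv ℝ (fderiv ℝ f) z 1 Complex.I := by
    rw [← h1]
    exact (((contDiff_one_dY hf).differentiable one_ne_zero z).lineDeriv_eq_fderiv).symm
  have e2 : dY (dX f) z = fderiv ℝ (fderiv ℝ f) z Complex.I 1 := by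
    rw [← h2]
    exact (((contDiff_one_dX hf).differentiable one_ne_zero z).lineDeriv_eq_fderiv).symm
  rw [e1, e2, fderiv_fderiv_symm hf]

/-! ### Integration by parts identities -/

section IBP

/-- `∫ φₓ · B(gₓ, g) = -½ ∫ φₓₓ · N(g)` for `g ∈ C²_c`, `φ ∈ C²` (and the same along `i`).
[folklore] -/
theorem integral_dphi_Bf (J : V →L[ℝ] V) {φ : ℂ → ℝ} {g : ℂ → V} (hφ : ContDiff ℝ 2 φ)
    (hg : ContDiff ℝ 2 g) (hgc : HasCompactSupport g) (v : ℂ) :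
    ∫ z, fderiv ℝ φ z v * Bf J (fderiv ℝ g z v) (g z) =
      -(1 / 2) * ∫ z, fderiv ℝ (fun y => fderiv ℝ φ y v) z v * Nf J (g z) := by
  -- `h = N ∘ g` has line derivative `2 B(gᵥ, g)` along `v`
  set h : ℂ → ℝ := fun z => Nf J (g z) with hh
  have hgd : ∀ z, HasFDerivAt g (fderiv ℝ g z) z := fun z =>
    (hg.differentiable (by norm_num) z).hasFDerivAt
  have hder : ∀ z, HasLineDerivAt ℝ h (2 * Bf J (fderiv ℝ g z v) (g z)) z v := by
    intro z
    have h1 := (hgd z).norm_sq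
    have h2 := (J.hasFDerivAt.comp z (hgd z)).norm_sq
    have h4 := (h1.add h2).hasLineDerivAt v
    have hfun : h = fun y => ‖g y‖ ^ 2 + ‖(J ∘ g) y‖ ^ 2 := by
      funext y; simp [hh, Nf_eq]
    rw [hfun]
    refine HasDerivAt.congr_deriv h4 ?_
    simp [innerSL_apply_apply, real_inner_comm]
    ring
  have hφ1 : ContDiff ℝ 1 (fun y => fderiv ℝ φ y v) :=
    (hφ.fderiv_right (m := 1) (by norm_num)).clm_apply contDiff_const
  have hφder : ∀ z, HasLineDerivAt ℝ (fun y => fderiv ℝ φ y v)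
      (fderiv ℝ (fun y => fderiv ℝ φ y v) z v) z v := fun z =>
    ((hφ1.differentiable one_ne_zero z).hasFDerivAt).hasLineDerivAt v
  -- supports and continuity
  have hK : IsCompact (tsupport g) := hgc
  have hgz : ∀ z, z ∉ tsupport g → g z = 0 := fun z hz => image_eq_zero_of_notMem_tsupport hz
  have hh_supp : HasCompactSupport h := by
    refine HasCompactSupport.intro hK fun z hz => ?_
    simp [hh, hgz z hz, Nf_eq]
  have hh'_supp : HasCompactSupport fun z => 2 * Bf J (fderiv ℝ g z v) (g z) := by
    refine HasCompactSupport.intro hK fun z hz => ?_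
    simp [hgz z hz]
  have hgc' : Continuous g := hg.continuous
  have hgv : Continuous fun z => fderiv ℝ g z v :=
    (hg.continuous_fderiv (by norm_num)).clm_apply continuous_const
  have hh_cont : Continuous h := continuous_Nf J hgc'
  have hh'_cont : Continuous fun z => 2 * Bf J (fderiv ℝ g z v) (g z) :=
    continuous_const.mul (continuous_Bf J hgv hgc')
  have hφv : Continuous fun y => fderiv ℝ φ y v := hφ1.continuous
  have hφvv : Continuous fun z => fderiv ℝ (fun y => fderiv ℝ φ y v) z v :=
    (hφ1.continuous_fderiv one_ne_zero).clm_apply continuous_const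
  have key := integral_bilinear_hasLineDerivAt_right_eq_neg_left_of_integrable
    (μ := volume) (B := ContinuousLinearMap.mul ℝ ℝ)
    (f := fun y => fderiv ℝ φ y v) (f' := fun z => fderiv ℝ (fun y => fderiv ℝ φ y v) z v)
    (g := h) (g' := fun z => 2 * Bf J (fderiv ℝ g z v) (g z)) (v := v)
    ?_ ?_ ?_ (fun z _ => hφder z) (fun z _ => hder z)
  · simp only [ContinuousLinearMap.mul_apply'] at key
    have e1 : ∫ z, fderiv ℝ φ z v * Bf J (fderiv ℝ g z v) (g z) =
        (1 / 2) * ∫ z, fderiv ℝ φ z v * (2 * Bf J (fderiv ℝ g z v) (g z)) := by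
      rw [← integral_const_mul]
      congr 1; funext z; ring
    rw [e1, key]
    simp [hh]
  · exact ((hφvv.mul hh_cont).integrable_of_hasCompactSupport (hh_supp.mul_left))
  · exact ((hφv.mul hh'_cont).integrable_of_hasCompactSupport (hh'_supp.mul_left))
  · exact ((hφv.mul hh_cont).integrable_of_hasCompactSupport (hh_supp.mul_left))

/-- `∫ B(gₓ, J g_y) = 0` for `g ∈ C²_c` (the symplectic area is a null Lagrangian). [folklore] -/
theorem integral_Bf_dX_J_dY {J : V →L[ℝ] V} (hJ : ∀ v, J (J v) = -v) {g : ℂ → V}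
    (hg : ContDiff ℝ 2 g) (hgc : HasCompactSupport g) :
    ∫ z, Bf J (dX g z) (J (dY g z)) = 0 := by
  have hgd : ∀ z, HasFDerivAt g (fderiv ℝ g z) z := fun z =>
    (hg.differentiable (by norm_num) z).hasFDerivAt
  have hK : IsCompact (tsupport g) := hgc
  have hgz : ∀ z, z ∉ tsupport g → g z = 0 := fun z hz => image_eq_zero_of_notMem_tsupport hz
  have hgc' : Continuous g := hg.continuous
  have hdX : Continuous (dX g) := continuous_dX hg
  have hdY : Continuous (dY g) := continuous_dY hg
  have hdXY : Continuous (dY (dX g)) :=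
    ((contDiff_one_dX hg).continuous_fderiv one_ne_zero).clm_apply continuous_const
  have hdYX : Continuous (dX (dY g)) :=
    ((contDiff_one_dY hg).continuous_fderiv one_ne_zero).clm_apply continuous_const
  -- supports
  have s0 : ∀ z, z ∉ tsupport g → dX g z = 0 := fun z hz => dX_eq_zero_of_notMem hz
  have s1 : ∀ z, z ∉ tsupport g → dY g z = 0 := fun z hz => dY_eq_zero_of_notMem hz
  have cs : ∀ (F : ℂ → ℝ), (∀ z, z ∉ tsupport g → F z = 0) → HasCompactSupport F :=
    fun F hF => HasCompactSupport.intro hK hF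
  -- (1) move `∂ₓ` : ∫ B(g, J g_yx) = - ∫ B(gₓ, J g_y)
  have k1 := integral_bilinear_hasLineDerivAt_right_eq_neg_left_of_integrable
    (μ := volume) (B := Bf J) (f := g) (f' := dX g)
    (g := fun z => J (dY g z)) (g' := fun z => J (dX (dY g) z)) (v := (1 : ℂ))
    ?_ ?_ ?_ (fun z _ => (hgd z).hasLineDerivAt 1) ?_
  -- (2) move `∂ᵧ` : ∫ B(gₓ, J g_y) = - ∫ B(g_xy, J g)
  · have k2 := integral_bilinear_hasLineDerivAt_right_eq_neg_left_of_integrable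
      (μ := volume) (B := Bf J) (f := dX g) (f' := dY (dX g))
      (g := fun z => J (g z)) (g' := fun z => J (dY g z)) (v := Complex.I)
      ?_ ?_ ?_ ?_ ?_
    · -- combine
      have e3 : ∫ z, Bf J (dY (dX g) z) (J (g z)) = - ∫ z, Bf J (g z) (J (dX (dY g) z)) := by
        rw [← integral_neg]
        congr 1; funext z
        rw [← dX_dY_eq_dY_dX hg z, Bf_comm J, Bf_J_left hJ]
      have : ∫ z, Bf J (dX g z) (J (dY g z)) = - ∫ z, Bf J (dX g z) (J (dY g z)) := by
        calc ∫ z, Bf J (dX g z) (J (dY g z))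
            = - ∫ z, Bf J (dY (dX g) z) (J (g z)) := k2
          _ = ∫ z, Bf J (g z) (J (dX (dY g) z)) := by rw [e3, neg_neg]
          _ = - ∫ z, Bf J (dX g z) (J (dY g z)) := k1
      linarith
    · exact (continuous_Bf J hdXY (J.continuous.comp hgc')).integrable_of_hasCompactSupport
        (cs _ fun z hz => by simp [hgz z hz])
    · exact (continuous_Bf J hdX (J.continuous.comp hdY)).integrable_of_hasCompactSupport
        (cs _ fun z hz => by simp [s0 z hz])
    · exact (continuous_Bf J hdX (J.continuous.comp hgc')).integrable_of_hasCompactSupport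
        (cs _ fun z hz => by simp [s0 z hz])
    · intro z _
      have := hasLineDerivAt_fderiv_apply hg z 1 Complex.I
      have e : fderiv ℝ (fderiv ℝ g) z Complex.I 1 = dY (dX g) z := by
        rw [← this.lineDeriv]
        exact ((contDiff_one_dX hg).differentiable one_ne_zero z).lineDeriv_eq_fderiv
      rw [← e]; exact this
    · intro z _
      exact (J.hasFDerivAt.comp z (hgd z)).hasLineDerivAt Complex.I
  · exact (continuous_Bf J hdX (J.continuous.comp hdY)).integrable_of_hasCompactSupport
      (cs _ fun z hz => by simp [s0 z hz])
  · exact (continuous_Bf J hgc' (J.continuous.comp hdYX)).integrable_of_hasCompactSupport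
      (cs _ fun z hz => by simp [hgz z hz])
  · exact (continuous_Bf J hgc' (J.continuous.comp hdY)).integrable_of_hasCompactSupport
      (cs _ fun z hz => by simp [hgz z hz])
  · intro z _
    have hd : HasFDerivAt (dY g) (fderiv ℝ (dY g) z) z :=
      ((contDiff_one_dY hg).differentiable one_ne_zero z).hasFDerivAt
    exact (J.hasFDerivAt.comp z hd).hasLineDerivAt 1

end IBP

/-! ### The Carleman estimate -/

/-- **Carleman estimate for `∂ₓ + J ∂ᵧ` with weight `e^{τφ}`**: for `f ∈ C²_c(ℂ; V)`,
`φ ∈ C²(ℂ; ℝ)` and `τ ∈ ℝ`,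
`2τ ∫ Δφ · e^{2τφ} N(f) ≤ ∫ e^{2τφ} N(∂ₓf + J∂ᵧf)`.
This is the real form of the identity `‖P g‖² = ‖P* g‖² + 2τ ∫ φ_{z z̄} |g|²` for
`P = e^{τφ} ∂̄ e^{-τφ}`, `g = e^{τφ} f` (Carleman's weighted `L²` method; L. Hörmander's form of
the identity; standard). [folklore] -/
theorem carleman_estimate {J : V →L[ℝ] V} (hJ : ∀ v, J (J v) = -v) {φ : ℂ → ℝ} {f : ℂ → V}
    (hφ : ContDiff ℝ 2 φ) (hf : ContDiff ℝ 2 f) (hfc : HasCompactSupport f) (τ : ℝ) :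
    2 * τ * ∫ z, lap φ z * (Real.exp (2 * τ * φ z) * Nf J (f z)) ≤
      ∫ z, Real.exp (2 * τ * φ z) * Nf J (Dop J f z) := by
  -- the conjugated function `g = e^{τφ} f`
  set g : ℂ → V := fun z => Real.exp (τ * φ z) • f z with hg_def
  have hexp : ContDiff ℝ 2 fun z => Real.exp (τ * φ z) := (contDiff_const.mul hφ).exp
  have hg : ContDiff ℝ 2 g := hexp.smul hf
  have hgc : HasCompactSupport g := hfc.smul_left
  have hφd : ∀ z, HasFDerivAt φ (fderiv ℝ φ z) z := fun z =>
    (hφ.differentiable (by norm_num) z).hasFDerivAt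
  have hfd : ∀ z, HasFDerivAt f (fderiv ℝ f z) z := fun z =>
    (hf.differentiable (by norm_num) z).hasFDerivAt
  have hed : ∀ z, HasFDerivAt (fun y => Real.exp (τ * φ y))
      (Real.exp (τ * φ z) • (τ • fderiv ℝ φ z)) z := fun z => ((hφd z).const_mul τ).exp
  have hgd : ∀ z, HasFDerivAt g (Real.exp (τ * φ z) • fderiv ℝ f z +
      (Real.exp (τ * φ z) • (τ • fderiv ℝ φ z)).smulRight (f z)) z :=
    fun z => (hed z).smul (hfd z)
  have hgv : ∀ z v, fderiv ℝ g z v =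
      Real.exp (τ * φ z) • (fderiv ℝ f z v + (τ * fderiv ℝ φ z v) • f z) := by
    intro z v
    rw [(hgd z).fderiv]
    simp only [add_apply, FunLike.coe_smul, Pi.smul_apply,
      ContinuousLinearMap.smulRight_apply, smul_eq_mul, smul_add, smul_smul, mul_assoc]
  -- `e^{τφ} ∂ᵥ f = ∂ᵥ g - τ ∂ᵥφ g`
  have hconj : ∀ z v, fderiv ℝ g z v - (τ * fderiv ℝ φ z v) • g z =
      Real.exp (τ * φ z) • fderiv ℝ f z v := by
    intro z v
    rw [hgv z v, hg_def]
    simp only [smul_add, smul_smul]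
    rw [mul_comm (τ * fderiv ℝ φ z v) (Real.exp (τ * φ z))]
    abel
  have hexp2 : ∀ z, Real.exp (τ * φ z) ^ 2 = Real.exp (2 * τ * φ z) := by
    intro z; rw [sq, ← Real.exp_add]; ring_nf
  -- the pointwise identity
  have hpt : ∀ z, Real.exp (2 * τ * φ z) * Nf J (Dop J f z) =
      Nf J ((dX g z + (τ * dX φ z) • g z) - J (dY g z + (τ * dY φ z) • g z))
        - 4 * τ * (dX φ z * Bf J (dX g z) (g z) + dY φ z * Bf J (dY g z) (g z))
        + 4 * Bf J (dX g z) (J (dY g z)) := by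
    intro z
    rw [← Nf_carleman_identity hJ]
    have e1 : dX g z - (τ * dX φ z) • g z = Real.exp (τ * φ z) • dX f z := hconj z 1
    have e2 : dY g z - (τ * dY φ z) • g z = Real.exp (τ * φ z) • dY f z := hconj z Complex.I
    rw [e1, e2, map_smul, ← smul_add, Nf_smul, hexp2]
    rfl
  have hNg : ∀ z, Nf J (g z) = Real.exp (2 * τ * φ z) * Nf J (f z) := by
    intro z; rw [hg_def]; simp only [Nf_smul, hexp2]
  -- supports and continuity
  have hK : IsCompact (tsupport f) := hfc
  have htg : tsupport g ⊆ tsupport f := tsupport_smul_subset_right _ _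
  have hfz : ∀ z, z ∉ tsupport f → f z = 0 := fun z hz => image_eq_zero_of_notMem_tsupport hz
  have hgz : ∀ z, z ∉ tsupport f → g z = 0 := fun z hz =>
    image_eq_zero_of_notMem_tsupport fun h => hz (htg h)
  have hgx : ∀ z, z ∉ tsupport f → dX g z = 0 := fun z hz =>
    dX_eq_zero_of_notMem fun h => hz (htg h)
  have hgy : ∀ z, z ∉ tsupport f → dY g z = 0 := fun z hz =>
    dY_eq_zero_of_notMem fun h => hz (htg h)
  have hfx : ∀ z, z ∉ tsupport f → dX f z = 0 := fun z hz => dX_eq_zero_of_notMem hz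
  have hfy : ∀ z, z ∉ tsupport f → dY f z = 0 := fun z hz => dY_eq_zero_of_notMem hz
  have cs : ∀ (F : ℂ → ℝ), (∀ z, z ∉ tsupport f → F z = 0) → HasCompactSupport F :=
    fun F hF => HasCompactSupport.intro hK hF
  have cg : Continuous g := hg.continuous
  have cgx : Continuous (dX g) := continuous_dX hg
  have cgy : Continuous (dY g) := continuous_dY hg
  have cf : Continuous f := hf.continuous
  have cfx : Continuous (dX f) := continuous_dX hf
  have cfy : Continuous (dY f) := continuous_dY hf
  have cφ : Continuous φ := hφ.continuous
  have cφx : Continuous (dX φ) := continuous_dX hφ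
  have cφy : Continuous (dY φ) := continuous_dY hφ
  have clap : Continuous (lap φ) :=
    (((contDiff_one_dX hφ).continuous_fderiv one_ne_zero).clm_apply continuous_const).add
      (((contDiff_one_dY hφ).continuous_fderiv one_ne_zero).clm_apply continuous_const)
  have ce2 : Continuous fun z => Real.exp (2 * τ * φ z) := (continuous_const.mul cφ).rexp
  -- the three pieces
  set P1 : ℂ → ℝ := fun z =>
    Nf J ((dX g z + (τ * dX φ z) • g z) - J (dY g z + (τ * dY φ z) • g z)) with hP1
  set P2 : ℂ → ℝ := fun z =>
    dX φ z * Bf J (dX g z) (g z) + dY φ z * Bf J (dY g z) (g z) with hP2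
  set P3 : ℂ → ℝ := fun z => Bf J (dX g z) (J (dY g z)) with hP3
  have iP1 : Integrable P1 := by
    refine Continuous.integrable_of_hasCompactSupport ?_ (cs _ fun z hz => ?_)
    · exact continuous_Nf J (((cgx.add ((continuous_const.mul cφx).smul cg)).sub
        (J.continuous.comp (cgy.add ((continuous_const.mul cφy).smul cg)))))
    · simp [hP1, hgx z hz, hgy z hz, hgz z hz, Nf_eq]
  have iP2 : Integrable P2 := by
    refine Continuous.integrable_of_hasCompactSupport ?_ (cs _ fun z hz => ?_)
    · exact (cφx.mul (continuous_Bf J cgx cg)).add (cφy.mul (continuous_Bf J cgy cg))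
    · simp [hP2, hgz z hz]
  have iP3 : Integrable P3 := by
    refine Continuous.integrable_of_hasCompactSupport ?_ (cs _ fun z hz => ?_)
    · exact continuous_Bf J cgx (J.continuous.comp cgy)
    · simp [hP3, hgx z hz]
  -- evaluate the pieces
  have vP3 : ∫ z, P3 z = 0 := integral_Bf_dX_J_dY hJ hg hgc
  have vP2 : ∫ z, P2 z = -(1 / 2) * ∫ z, lap φ z * Nf J (g z) := by
    have i1 : ∫ z, dX φ z * Bf J (dX g z) (g z) =
        -(1 / 2) * ∫ z, dX (dX φ) z * Nf J (g z) := integral_dphi_Bf J hφ hg hgc 1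
    have i2 : ∫ z, dY φ z * Bf J (dY g z) (g z) =
        -(1 / 2) * ∫ z, dY (dY φ) z * Nf J (g z) := integral_dphi_Bf J hφ hg hgc Complex.I
    have j1 : Integrable fun z => dX φ z * Bf J (dX g z) (g z) :=
      (cφx.mul (continuous_Bf J cgx cg)).integrable_of_hasCompactSupport
        (cs _ fun z hz => by simp [hgz z hz])
    have j2 : Integrable fun z => dY φ z * Bf J (dY g z) (g z) :=
      (cφy.mul (continuous_Bf J cgy cg)).integrable_of_hasCompactSupport
        (cs _ fun z hz => by simp [hgz z hz])
    have j3 : Integrable fun z => dX (dX φ) z * Nf J (g z) :=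
      ((((contDiff_one_dX hφ).continuous_fderiv one_ne_zero).clm_apply continuous_const).mul
        (continuous_Nf J cg)).integrable_of_hasCompactSupport
        (cs _ fun z hz => by simp [hgz z hz, Nf_eq])
    have j4 : Integrable fun z => dY (dY φ) z * Nf J (g z) :=
      ((((contDiff_one_dY hφ).continuous_fderiv one_ne_zero).clm_apply continuous_const).mul
        (continuous_Nf J cg)).integrable_of_hasCompactSupport
        (cs _ fun z hz => by simp [hgz z hz, Nf_eq])
    simp only [hP2]
    rw [integral_add j1 j2, i1, i2, ← mul_add, ← integral_add j3 j4]
    congr 1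
    refine integral_congr_ae (Eventually.of_forall fun z => ?_)
    simp only [lap]; ring
  have vP1 : 0 ≤ ∫ z, P1 z := integral_nonneg fun z => Nf_nonneg J _
  -- assemble
  have hL : ∫ z, Real.exp (2 * τ * φ z) * Nf J (Dop J f z) =
      (∫ z, P1 z) - 4 * τ * (∫ z, P2 z) + 4 * ∫ z, P3 z := by
    have hfun : (fun z => Real.exp (2 * τ * φ z) * Nf J (Dop J f z)) =
        fun z => (P1 z - 4 * τ * P2 z) + 4 * P3 z := by
      funext z; simp only [hP1, hP2, hP3, hpt z]
    have i2' : Integrable fun z => 4 * τ * P2 z := iP2.const_mul _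
    have i12 : Integrable fun z => P1 z - 4 * τ * P2 z := iP1.sub i2'
    have i3' : Integrable fun z => 4 * P3 z := iP3.const_mul _
    have hA := integral_add i12 i3'
    have hS := integral_sub iP1 i2'
    have hC2 := integral_const_mul (μ := volume) (4 * τ) P2
    have hC3 := integral_const_mul (μ := volume) 4 P3
    rw [hfun, hA, hS, hC2, hC3]
  have hR : ∫ z, lap φ z * (Real.exp (2 * τ * φ z) * Nf J (f z)) =
      ∫ z, lap φ z * Nf J (g z) := by
    refine integral_congr_ae (Eventually.of_forall fun z => ?_)
    simp only [hNg z]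
  rw [hL, hR, vP3, vP2]
  nlinarith [vP1]

/-! ### Vanishing from the Carleman estimate -/

/-- If `f ∈ C²_c` satisfies `N(∂ₓf + J∂ᵧf) ≤ a ‖f‖² + E` with an error `E ≥ 0` living in the
sub-level set `{φ ≤ l}` of a weight `φ` which is strictly subharmonic (`Δφ ≥ μ > 0`) on the
support of `f`, then `f` vanishes on `{φ > l}` (let `τ → ∞` in the Carleman estimate).
[folklore] -/
theorem eq_zero_of_carleman {J : V →L[ℝ] V} (hJ : ∀ v, J (J v) = -v) {φ : ℂ → ℝ} {f : ℂ → V}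
    {E : ℂ → ℝ} {a μ l : ℝ} (hφ : ContDiff ℝ 2 φ) (hf : ContDiff ℝ 2 f)
    (hfc : HasCompactSupport f) (hE : Continuous E) (hEc : HasCompactSupport E)
    (hE0 : ∀ z, 0 ≤ E z) (ha : 0 ≤ a) (hμ : 0 < μ) (hlap : ∀ z, f z ≠ 0 → μ ≤ lap φ z)
    (hineq : ∀ z, Nf J (Dop J f z) ≤ a * ‖f z‖ ^ 2 + E z) (hEl : ∀ z, E z ≠ 0 → φ z ≤ l) :
    ∀ z, l < φ z → f z = 0 := by
  -- continuity and supports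
  have hK : IsCompact (tsupport f) := hfc
  have hfz : ∀ z, z ∉ tsupport f → f z = 0 := fun z hz => image_eq_zero_of_notMem_tsupport hz
  have hfx : ∀ z, z ∉ tsupport f → dX f z = 0 := fun z hz => dX_eq_zero_of_notMem hz
  have hfy : ∀ z, z ∉ tsupport f → dY f z = 0 := fun z hz => dY_eq_zero_of_notMem hz
  have cs : ∀ (F : ℂ → ℝ), (∀ z, z ∉ tsupport f → F z = 0) → HasCompactSupport F :=
    fun F hF => HasCompactSupport.intro hK hF
  have cf : Continuous f := hf.continuous
  have cφ : Continuous φ := hφ.continuous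
  have cNf : Continuous fun z => Nf J (f z) := continuous_Nf J cf
  have cND : Continuous fun z => Nf J (Dop J f z) :=
    continuous_Nf J ((continuous_dX hf).add (J.continuous.comp (continuous_dY hf)))
  have clap : Continuous (lap φ) :=
    (((contDiff_one_dX hφ).continuous_fderiv one_ne_zero).clm_apply continuous_const).add
      (((contDiff_one_dY hφ).continuous_fderiv one_ne_zero).clm_apply continuous_const)
  have ce : ∀ τ : ℝ, Continuous fun z => Real.exp (2 * τ * φ z) := fun τ =>
    (continuous_const.mul cφ).rexp
  have sNf : ∀ z, z ∉ tsupport f → Nf J (f z) = 0 := fun z hz => by simp [hfz z hz, Nf_eq]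
  -- the test function `ρ = (φ - l)⁺`
  set ρ : ℂ → ℝ := fun z => max (φ z - l) 0 with hρ
  have cρ : Continuous ρ := (cφ.sub continuous_const).max continuous_const
  have hρ0 : ∀ z, 0 ≤ ρ z := fun z => le_max_right _ _
  have hρexp : ∀ τ : ℝ, 1 / 2 ≤ τ → ∀ z, ρ z ≤ Real.exp (2 * τ * (φ z - l)) := by
    intro τ hτ z
    show max (φ z - l) 0 ≤ _
    rcases le_or_gt (φ z - l) 0 with h | h
    · rw [max_eq_right h]; exact (Real.exp_pos _).le
    · rw [max_eq_left h.le]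
      have h1 : φ z - l ≤ 2 * τ * (φ z - l) := by nlinarith
      linarith [Real.add_one_le_exp (2 * τ * (φ z - l))]
  set Y : ℝ := ∫ z, ρ z * Nf J (f z) with hY
  have iY : Integrable fun z => ρ z * Nf J (f z) :=
    (cρ.mul cNf).integrable_of_hasCompactSupport (cs _ fun z hz => by simp [sNf z hz])
  have hY0 : 0 ≤ Y := integral_nonneg fun z => mul_nonneg (hρ0 z) (Nf_nonneg J _)
  set C : ℝ := (∫ z, E z) / μ with hC
  have hE_int : Integrable E := hE.integrable_of_hasCompactSupport hEc
  have hC0 : 0 ≤ C := div_nonneg (integral_nonneg hE0) hμ.le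
  -- the main estimate: `Y ≤ C / τ` for large `τ`
  have hmain : ∀ τ : ℝ, 1 / 2 ≤ τ → a / μ ≤ τ → Y ≤ C / τ := by
    intro τ hτ hτa
    have hτ0 : 0 < τ := by linarith
    set X : ℝ := ∫ z, Real.exp (2 * τ * φ z) * Nf J (f z) with hX
    have iX : Integrable fun z => Real.exp (2 * τ * φ z) * Nf J (f z) :=
      ((ce τ).mul cNf).integrable_of_hasCompactSupport (cs _ fun z hz => by simp [sNf z hz])
    have hX0 : 0 ≤ X := integral_nonneg fun z => mul_nonneg (Real.exp_pos _).le (Nf_nonneg J _)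
    -- Carleman
    have hcar := carleman_estimate hJ hφ hf hfc τ
    -- lower bound of the left-hand side
    have iL : Integrable fun z => lap φ z * (Real.exp (2 * τ * φ z) * Nf J (f z)) :=
      (clap.mul ((ce τ).mul cNf)).integrable_of_hasCompactSupport
        (cs _ fun z hz => by simp [sNf z hz])
    have hlow : μ * X ≤ ∫ z, lap φ z * (Real.exp (2 * τ * φ z) * Nf J (f z)) := by
      rw [hX, ← integral_const_mul]
      refine integral_mono (iX.const_mul μ) iL fun z => ?_
      by_cases hz : f z = 0
      · simp [hz, Nf_eq]
      · exact mul_le_mul_of_nonneg_right (hlap z hz)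
          (mul_nonneg (Real.exp_pos _).le (Nf_nonneg J _))
    -- upper bound of the right-hand side
    have iR : Integrable fun z => Real.exp (2 * τ * φ z) * Nf J (Dop J f z) :=
      ((ce τ).mul cND).integrable_of_hasCompactSupport
        (cs _ fun z hz => by simp [hfx z hz, hfy z hz, Dop, Nf_eq])
    have iE' : Integrable fun z => Real.exp (2 * τ * l) * E z := hE_int.const_mul _
    have hup : ∫ z, Real.exp (2 * τ * φ z) * Nf J (Dop J f z) ≤
        a * X + Real.exp (2 * τ * l) * ∫ z, E z := by
      rw [hX, ← integral_const_mul, ← integral_const_mul, ← integral_add (iX.const_mul a) iE']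
      refine integral_mono iR ((iX.const_mul a).add iE') fun z => ?_
      have h1 : Real.exp (2 * τ * φ z) * E z ≤ Real.exp (2 * τ * l) * E z := by
        by_cases hz : E z = 0
        · simp [hz]
        · refine mul_le_mul_of_nonneg_right ?_ (hE0 z)
          exact Real.exp_le_exp.mpr (by nlinarith [hEl z hz])
      have h2 : Real.exp (2 * τ * φ z) * Nf J (Dop J f z) ≤
          Real.exp (2 * τ * φ z) * (a * Nf J (f z) + E z) := by
        refine mul_le_mul_of_nonneg_left ?_ (Real.exp_pos _).le
        have := sq_norm_le_Nf J (f z)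
        nlinarith [hineq z]
      nlinarith [h1, h2, Real.exp_pos (2 * τ * φ z)]
    -- combine: `τ μ X ≤ e^{2τl} ∫ E`
    have hcomb : τ * μ * X ≤ Real.exp (2 * τ * l) * ∫ z, E z := by
      have h1 : 2 * τ * (μ * X) ≤ a * X + Real.exp (2 * τ * l) * ∫ z, E z :=
        le_trans (by nlinarith [hlow, hτ0.le]) (le_trans hcar hup)
      have h2 : a * X ≤ τ * μ * X := by
        have : a ≤ τ * μ := by rwa [div_le_iff₀ hμ] at hτa
        exact mul_le_mul_of_nonneg_right this hX0
      nlinarith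
    -- `Y ≤ e^{-2τl} X`
    have iX' : Integrable fun z => Real.exp (2 * τ * (φ z - l)) * Nf J (f z) :=
      ((continuous_const.mul (cφ.sub continuous_const)).rexp.mul cNf)
        |>.integrable_of_hasCompactSupport (cs _ fun z hz => by simp [sNf z hz])
    have hYX : Y ≤ Real.exp (-(2 * τ * l)) * X := by
      have h1 : Y ≤ ∫ z, Real.exp (2 * τ * (φ z - l)) * Nf J (f z) :=
        integral_mono iY iX' fun z =>
          mul_le_mul_of_nonneg_right (hρexp τ hτ z) (Nf_nonneg J _)
      have h2 : ∫ z, Real.exp (2 * τ * (φ z - l)) * Nf J (f z) =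
          Real.exp (-(2 * τ * l)) * X := by
        rw [hX, ← integral_const_mul]
        refine integral_congr_ae (Eventually.of_forall fun z => ?_)
        simp only
        rw [← mul_assoc, ← Real.exp_add]
        ring_nf
      linarith
    have hexp_pos := Real.exp_pos (-(2 * τ * l))
    have h3 : Real.exp (-(2 * τ * l)) * (τ * μ * X) ≤ ∫ z, E z := by
      calc Real.exp (-(2 * τ * l)) * (τ * μ * X)
          ≤ Real.exp (-(2 * τ * l)) * (Real.exp (2 * τ * l) * ∫ z, E z) :=
            mul_le_mul_of_nonneg_left hcomb hexp_pos.le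
        _ = ∫ z, E z := by
            rw [← mul_assoc, ← Real.exp_add, show -(2 * τ * l) + 2 * τ * l = 0 by ring,
              Real.exp_zero, one_mul]
    have h4 : τ * μ * Y ≤ ∫ z, E z := by
      have := mul_le_mul_of_nonneg_left hYX (mul_pos hτ0 hμ).le
      linarith [this, h3]
    rw [hC, div_div, le_div_iff₀ (mul_pos hμ hτ0)]
    linarith
  -- hence `Y = 0`
  have hYle : Y ≤ 0 := by
    by_contra hpos
    push Not at hpos
    set τ : ℝ := max (max (1 / 2) (a / μ)) (C / Y + 1) with hτ
    have h1 : 1 / 2 ≤ τ := le_trans (le_max_left _ _) (le_max_left _ _)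
    have h2 : a / μ ≤ τ := le_trans (le_max_right _ _) (le_max_left _ _)
    have h3 : C / Y + 1 ≤ τ := le_max_right _ _
    have hτ0 : 0 < τ := by linarith
    have h4 := hmain τ h1 h2
    rw [le_div_iff₀ hτ0] at h4
    have h5 : C < (C / Y + 1) * Y := by
      rw [add_mul, div_mul_cancel₀ _ hpos.ne']; linarith
    nlinarith [mul_le_mul_of_nonneg_right h3 hpos.le]
  have hY00 : Y = 0 := le_antisymm hYle hY0
  have hzero : (fun z => ρ z * Nf J (f z)) = 0 := by
    have h1 : (fun z => ρ z * Nf J (f z)) =ᵐ[volume] 0 :=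
      (integral_eq_zero_iff_of_nonneg (fun z => mul_nonneg (hρ0 z) (Nf_nonneg J _)) iY).mp
        hY00
    exact ((cρ.mul cNf).ae_eq_iff_eq volume continuous_const).mp h1
  intro z hz
  have h1 : ρ z * Nf J (f z) = 0 := by
    have := congrArg (fun F => F z) hzero
    simpa using this
  have hρz : 0 < ρ z := by rw [hρ]; exact lt_max_of_lt_left (by linarith)
  have h2 : Nf J (f z) = 0 := by
    rcases mul_eq_zero.mp h1 with h | h
    · exact absurd h hρz.ne'
    · exact h
  exact (Nf_eq_zero_iff J _).mp h2

/-! ### The weight `φ(z) = (κ + ‖z - b‖²)⁻¹` -/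

section Weight

/-- The Carleman weight `(κ + ‖z - b‖²)⁻¹`: radially decreasing about `b`, smooth for `κ > 0`,
and strictly subharmonic where `‖z - b‖² > κ`. [folklore] -/
def weight (b : ℂ) (κ : ℝ) (z : ℂ) : ℝ := (κ + ‖z - b‖ ^ 2)⁻¹

/-- `⟪w, 1⟫_ℝ = re w` for the real inner product on `ℂ`. [folklore] -/
theorem real_inner_one_right (w : ℂ) : ⟪w, (1 : ℂ)⟫_ℝ = w.re := by
  simp [Complex.inner]

/-- `⟪w, i⟫_ℝ = im w` for the real inner product on `ℂ`. [folklore] -/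
theorem real_inner_I_right (w : ℂ) : ⟪w, Complex.I⟫_ℝ = w.im := by
  simp [Complex.inner]

/-- `D(κ + ‖y - b‖²)(z) = 2⟪z - b, ·⟫`. [folklore] -/
theorem hasFDerivAt_den (b : ℂ) (κ : ℝ) (z : ℂ) :
    HasFDerivAt (fun y : ℂ => κ + ‖y - b‖ ^ 2) (2 • innerSL ℝ (z - b)) z := by
  have h := (((hasFDerivAt_id z).sub_const b).norm_sq).const_add κ
  refine h.congr_fderiv ?_
  ext v
  simp [innerSL_apply_apply]

/-- `D(re (y - b)) = re`. [folklore] -/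
theorem hasFDerivAt_re_sub (b z : ℂ) :
    HasFDerivAt (fun y : ℂ => (y - b).re) Complex.reCLM z := by
  have h := Complex.reCLM.hasFDerivAt.comp z ((hasFDerivAt_id z).sub_const b)
  refine h.congr_fderiv ?_
  ext v; simp

/-- `D(im (y - b)) = im`. [folklore] -/
theorem hasFDerivAt_im_sub (b z : ℂ) :
    HasFDerivAt (fun y : ℂ => (y - b).im) Complex.imCLM z := by
  have h := Complex.imCLM.hasFDerivAt.comp z ((hasFDerivAt_id z).sub_const b)
  refine h.congr_fderiv ?_
  ext v; simp

variable (b : ℂ) {κ : ℝ} (hκ : 0 < κ)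
include hκ

/-- The denominator `κ + ‖z - b‖²` is positive for `κ > 0`. [folklore] -/
theorem weight_den_pos (z : ℂ) : 0 < κ + ‖z - b‖ ^ 2 := by positivity

/-- The weight is positive. [folklore] -/
theorem weight_pos (z : ℂ) : 0 < weight b κ z := inv_pos.mpr (weight_den_pos b hκ z)

/-- The weight is smooth for `κ > 0`. [folklore] -/
theorem contDiff_weight {n : WithTop ℕ∞} : ContDiff ℝ n (weight b κ) := by
  have h1 : ContDiff ℝ n fun z : ℂ => κ + ‖z - b‖ ^ 2 :=
    contDiff_const.add ((contDiff_id.sub contDiff_const).norm_sq ℝ)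
  exact h1.inv fun z => (weight_den_pos b hκ z).ne'

/-- `Dφ(z) v = -2 ⟪z - b, v⟫ φ(z)²` for the weight `φ`. [folklore] -/
theorem fderiv_weight (z v : ℂ) :
    fderiv ℝ (weight b κ) z v = -2 * ⟪z - b, v⟫_ℝ * weight b κ z ^ 2 := by
  have hne : κ + ‖z - b‖ ^ 2 ≠ 0 := (weight_den_pos b hκ z).ne'
  have h := (hasFDerivAt_inv hne).comp z (hasFDerivAt_den b κ z)
  have e : ((fun x : ℝ => x⁻¹) ∘ fun y : ℂ => κ + ‖y - b‖ ^ 2) = weight b κ := rfl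
  rw [e] at h
  rw [h.fderiv]
  simp [innerSL_apply_apply, weight, inv_pow]
  ring

/-- The weight is differentiable. [folklore] -/
theorem differentiable_weight : Differentiable ℝ (weight b κ) :=
  (contDiff_weight b hκ (n := 1)).differentiable one_ne_zero

/-- The weight has its Fréchet derivative. [folklore] -/
theorem hasFDerivAt_weight (z : ℂ) : HasFDerivAt (weight b κ) (fderiv ℝ (weight b κ) z) z :=
  (differentiable_weight b hκ z).hasFDerivAt

/-- `∂ₓφ(z) = -2 re(z - b) φ(z)²`. [folklore] -/
theorem dX_weight : dX (weight b κ) = fun z => -2 * (z - b).re * weight b κ z ^ 2 := by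
  funext z; simp only [dX, fderiv_weight b hκ, real_inner_one_right]

/-- `∂ᵧφ(z) = -2 im(z - b) φ(z)²`. [folklore] -/
theorem dY_weight : dY (weight b κ) = fun z => -2 * (z - b).im * weight b κ z ^ 2 := by
  funext z; simp only [dY, fderiv_weight b hκ, real_inner_I_right]

/-- `∂ₓ∂ₓφ = -2φ² + 8 re(z - b)² φ³`. [folklore] -/
theorem dX_dX_weight (z : ℂ) :
    dX (dX (weight b κ)) z = -2 * weight b κ z ^ 2 + 8 * (z - b).re ^ 2 * weight b κ z ^ 3 := by
  rw [dX_weight b hκ]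
  have hw := hasFDerivAt_weight b hκ z
  have h1 : HasFDerivAt (fun y : ℂ => -2 * (y - b).re) ((-2 : ℝ) • Complex.reCLM) z :=
    (hasFDerivAt_re_sub b z).const_mul (-2)
  have h2 := hw.fun_mul hw
  have h3 := h1.fun_mul h2
  have e : (fun z => -2 * (z - b).re * weight b κ z ^ 2) =
      fun y => -2 * (y - b).re * (weight b κ y * weight b κ y) := by
    funext y; ring
  simp only [dX]
  rw [e, h3.fderiv]
  simp only [add_apply, FunLike.coe_smul, Pi.smul_apply, smul_eq_mul, Complex.reCLM_apply,
    Complex.one_re, fderiv_weight b hκ, real_inner_one_right]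
  ring

/-- `∂ᵧ∂ᵧφ = -2φ² + 8 im(z - b)² φ³`. [folklore] -/
theorem dY_dY_weight (z : ℂ) :
    dY (dY (weight b κ)) z = -2 * weight b κ z ^ 2 + 8 * (z - b).im ^ 2 * weight b κ z ^ 3 := by
  rw [dY_weight b hκ]
  have hw := hasFDerivAt_weight b hκ z
  have h1 : HasFDerivAt (fun y : ℂ => -2 * (y - b).im) ((-2 : ℝ) • Complex.imCLM) z :=
    (hasFDerivAt_im_sub b z).const_mul (-2)
  have h2 := hw.fun_mul hw
  have h3 := h1.fun_mul h2
  have e : (fun z => -2 * (z - b).im * weight b κ z ^ 2) =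
      fun y => -2 * (y - b).im * (weight b κ y * weight b κ y) := by
    funext y; ring
  simp only [dY]
  rw [e, h3.fderiv]
  simp only [add_apply, FunLike.coe_smul, Pi.smul_apply, smul_eq_mul, Complex.imCLM_apply,
    Complex.I_im, fderiv_weight b hκ, real_inner_I_right]
  ring

/-- `Δ (κ + ‖z - b‖²)⁻¹ = 4 (‖z - b‖² - κ) (κ + ‖z - b‖²)⁻³`. [folklore] -/
theorem lap_weight (z : ℂ) :
    lap (weight b κ) z = 4 * (‖z - b‖ ^ 2 - κ) * weight b κ z ^ 3 := by
  rw [lap, dX_dX_weight b hκ, dY_dY_weight b hκ]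
  have hs : ‖z - b‖ ^ 2 = (z - b).re ^ 2 + (z - b).im ^ 2 := by
    rw [Complex.sq_norm, Complex.normSq_apply]; ring
  have hq : weight b κ z * (κ + ‖z - b‖ ^ 2) = 1 :=
    inv_mul_cancel₀ (weight_den_pos b hκ z).ne'
  rw [hs] at hq ⊢
  have e2 : weight b κ z ^ 2 = weight b κ z ^ 3 * (κ + ((z - b).re ^ 2 + (z - b).im ^ 2)) := by
    calc weight b κ z ^ 2 = weight b κ z ^ 2 * 1 := by ring
      _ = weight b κ z ^ 2 * (weight b κ z * (κ + ((z - b).re ^ 2 + (z - b).im ^ 2))) := by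
          rw [hq]
      _ = _ := by ring
  rw [e2]; ring

/-- Lower bound for the Laplacian of the weight on an annulus about `b`. [folklore] -/
theorem lap_weight_ge {z : ℂ} {σ S : ℝ} (hκσ : 2 * κ ≤ σ ^ 2) (hσz : σ ≤ ‖z - b‖)
    (hzS : ‖z - b‖ ≤ S) (hσ : 0 ≤ σ) :
    2 * κ / (κ + S ^ 2) ^ 3 ≤ lap (weight b κ) z := by
  rw [lap_weight b hκ]
  have h1 : σ ^ 2 ≤ ‖z - b‖ ^ 2 := pow_le_pow_left₀ hσ hσz 2
  have h2 : ‖z - b‖ ^ 2 ≤ S ^ 2 := pow_le_pow_left₀ (norm_nonneg _) hzS 2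
  have hden : 0 < κ + ‖z - b‖ ^ 2 := weight_den_pos b hκ z
  have h3 : (κ + S ^ 2)⁻¹ ≤ weight b κ z := by
    rw [weight]; exact inv_anti₀ hden (by linarith)
  have h4 : 0 ≤ (κ + S ^ 2)⁻¹ := inv_nonneg.mpr (by nlinarith)
  have h5 : (κ + S ^ 2)⁻¹ ^ 3 ≤ weight b κ z ^ 3 := pow_le_pow_left₀ h4 h3 3
  calc 2 * κ / (κ + S ^ 2) ^ 3 = 2 * κ * (κ + S ^ 2)⁻¹ ^ 3 := by rw [div_eq_mul_inv, inv_pow]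
    _ ≤ 2 * κ * weight b κ z ^ 3 := mul_le_mul_of_nonneg_left h5 (by linarith)
    _ ≤ 4 * (‖z - b‖ ^ 2 - κ) * weight b κ z ^ 3 :=
        mul_le_mul_of_nonneg_right (by linarith) (pow_nonneg (weight_pos b hκ z).le 3)

/-- Super-level sets of the weight are discs about `b`. [folklore] -/
theorem weight_lt_weight_iff {z : ℂ} {R : ℝ} (hR : 0 ≤ R) :
    (κ + R ^ 2)⁻¹ < weight b κ z ↔ ‖z - b‖ < R := by
  rw [weight, inv_lt_inv₀ (by positivity) (weight_den_pos b hκ z), add_lt_add_iff_left]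
  exact pow_lt_pow_iff_left₀ (norm_nonneg _) hR two_ne_zero

/-- The weight is radially decreasing: `R ≤ ‖z - b‖ → φ z ≤ (κ + R²)⁻¹`. [folklore] -/
theorem weight_le_of_le_norm {z : ℂ} {R : ℝ} (hR : 0 ≤ R) (h : R ≤ ‖z - b‖) :
    weight b κ z ≤ (κ + R ^ 2)⁻¹ := by
  rw [weight]
  exact inv_anti₀ (by positivity) (by nlinarith [pow_le_pow_left₀ hR h 2])

end Weight

/-! ### Cut-offs and products with functions defined on an open set -/

section Cutoff

variable {U : Set ℂ}

/-- `tsupport (∂ₓ g) ⊆ tsupport g`. [folklore] -/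
theorem tsupport_dX_subset (g : ℂ → W) : tsupport (dX g) ⊆ tsupport g := by
  have h1 : Function.support (dX g) ⊆ Function.support (fderiv ℝ g) := by
    intro y hy h
    exact hy (by simp [dX, h])
  exact (closure_mono h1).trans (tsupport_fderiv_subset ℝ)

/-- `tsupport (∂ᵧ g) ⊆ tsupport g`. [folklore] -/
theorem tsupport_dY_subset (g : ℂ → W) : tsupport (dY g) ⊆ tsupport g := by
  have h1 : Function.support (dY g) ⊆ Function.support (fderiv ℝ g) := by
    intro y hy h
    exact hy (by simp [dY, h])
  exact (closure_mono h1).trans (tsupport_fderiv_subset ℝ)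

/-- A `Cⁿ` function on an open set times a `Cⁿ` cut-off supported inside it is `Cⁿ` on the
whole plane. [folklore] -/
theorem contDiff_smul_of_tsupport_subset {χ : ℂ → ℝ} {w : ℂ → V} {n : WithTop ℕ∞}
    (hU : IsOpen U) (hχ : ContDiff ℝ n χ) (hsub : tsupport χ ⊆ U) (hw : ContDiffOn ℝ n w U) :
    ContDiff ℝ n fun z => χ z • w z := by
  rw [contDiff_iff_contDiffAt]
  intro z
  by_cases hz : z ∈ U
  · exact hχ.contDiffAt.smul (hw.contDiffAt (hU.mem_nhds hz))
  · have h0 : χ =ᶠ[𝓝 z] 0 := notMem_tsupport_iff_eventuallyEq.mp fun h => hz (hsub h)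
    have : (fun y => χ y • w y) =ᶠ[𝓝 z] fun _ => 0 := by
      filter_upwards [h0] with y hy
      simp [hy]
    exact contDiffAt_const.congr_of_eventuallyEq this

/-- A function continuous on an open set times a continuous cut-off supported inside it is
continuous on the whole plane. [folklore] -/
theorem continuous_smul_of_tsupport_subset {ψ : ℂ → ℝ} {w : ℂ → V} (hU : IsOpen U)
    (hψ : Continuous ψ) (hsub : tsupport ψ ⊆ U) (hw : ContinuousOn w U) :
    Continuous fun z => ψ z • w z := by
  rw [continuous_iff_continuousAt]
  intro z
  by_cases hz : z ∈ U
  · exact hψ.continuousAt.smul (hw.continuousAt (hU.mem_nhds hz))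
  · have h0 : ψ =ᶠ[𝓝 z] 0 := notMem_tsupport_iff_eventuallyEq.mp fun h => hz (hsub h)
    have : (fun y => ψ y • w y) =ᶠ[𝓝 z] fun _ => 0 := by
      filter_upwards [h0] with y hy
      simp [hy]
    exact continuousAt_const.congr_of_eventuallyEq this

/-- The Leibniz rule for a cut-off times a function differentiable on an open set containing the
support of the cut-off; outside that set both sides vanish. [folklore] -/
theorem fderiv_smul_apply_of_tsupport_subset {χ : ℂ → ℝ} {w : ℂ → V} (hU : IsOpen U)
    (hχ : Differentiable ℝ χ) (hsub : tsupport χ ⊆ U) (hw : DifferentiableOn ℝ w U) (z v : ℂ) :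
    fderiv ℝ (fun y => χ y • w y) z v = χ z • fderiv ℝ w z v + fderiv ℝ χ z v • w z := by
  by_cases hz : z ∈ U
  · rw [fderiv_fun_smul (hχ z) (hw.differentiableAt (hU.mem_nhds hz))]
    simp
  · have hzt : z ∉ tsupport χ := fun h => hz (hsub h)
    have h0 : χ =ᶠ[𝓝 z] 0 := notMem_tsupport_iff_eventuallyEq.mp hzt
    have h1 : (fun y => χ y • w y) =ᶠ[𝓝 z] fun _ => 0 := by
      filter_upwards [h0] with y hy
      simp [hy]
    rw [h1.fderiv_eq, fderiv_of_notMem_tsupport ℝ hzt, image_eq_zero_of_notMem_tsupport hzt]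
    simp

/-- The differential of a bump function vanishes off the annulus `rIn ≤ dist z c ≤ rOut`.
[folklore] -/
theorem bump_rIn_le_dist_of_fderiv_ne_zero {c : ℂ} (χ : ContDiffBump c) {z : ℂ}
    (hz : fderiv ℝ (χ : ℂ → ℝ) z ≠ 0) : χ.rIn ≤ dist z c ∧ dist z c ≤ χ.rOut := by
  constructor
  · by_contra h
    push Not at h
    have h1 : (χ : ℂ → ℝ) =ᶠ[𝓝 z] fun _ => (1 : ℝ) := χ.eventuallyEq_one_of_mem_ball h
    exact hz (by rw [h1.fderiv_eq]; simp)
  · by_contra h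
    push Not at h
    refine hz (fderiv_of_notMem_tsupport ℝ ?_)
    rw [χ.tsupport_eq]
    simpa using h

end Cutoff

/-! ### The local step: zeros propagate across a circle -/

section LocalStep

/-- The gain in radius in one local step (depends only on the radius `ρ` of the disc of zeros
and the room `δ` available). [folklore] -/
def stepRadius (ρ δ : ℝ) : ℝ :=
  Real.sqrt (min ρ (δ / 8) ^ 2 + δ ^ 2 / 4) - min ρ (δ / 8)

/-- The step radius is positive. [folklore] -/
theorem stepRadius_pos {ρ δ : ℝ} (hρ : 0 < ρ) (hδ : 0 < δ) : 0 < stepRadius ρ δ := by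
  rw [stepRadius, sub_pos]
  have h0 : 0 ≤ min ρ (δ / 8) := le_min hρ.le (by linarith)
  calc min ρ (δ / 8) = Real.sqrt (min ρ (δ / 8) ^ 2) := (Real.sqrt_sq h0).symm
    _ < Real.sqrt (min ρ (δ / 8) ^ 2 + δ ^ 2 / 4) :=
        Real.sqrt_lt_sqrt (sq_nonneg _) (by nlinarith)

variable {J : V →L[ℝ] V}

/-- `N(D f) ≤ 2(1 + ‖J‖²)(M² ‖f‖² + ‖e‖²)` when `‖D f - e‖ ≤ M ‖f‖`-type bounds hold. [folklore] -/
theorem Nf_le_of_norm_le (J : V →L[ℝ] V) {x y : V} {M m : ℝ} (h : ‖x‖ ≤ M * m + ‖y‖) :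
    Nf J (x) ≤ 2 * (1 + ‖J‖ ^ 2) * M ^ 2 * m ^ 2 + 2 * (1 + ‖J‖ ^ 2) * ‖y‖ ^ 2 := by
  have h1 := Nf_le J x
  have hx : ‖x‖ ^ 2 ≤ (M * m + ‖y‖) ^ 2 := pow_le_pow_left₀ (norm_nonneg x) h 2
  have h2 : ‖x‖ ^ 2 ≤ 2 * (M * m) ^ 2 + 2 * ‖y‖ ^ 2 := by
    nlinarith [sq_nonneg (M * m - ‖y‖)]
  have h3 : 0 ≤ 1 + ‖J‖ ^ 2 := by positivity
  nlinarith [mul_le_mul_of_nonneg_left h2 h3]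

/-- **Local step.** Let `w` be `C²` on an open set `U` with `‖∂ₓw + J∂ᵧw‖ ≤ M ‖w‖` there, and
suppose `w = 0` on the disc `ball z' ρ`. If `p` lies on the boundary circle and
`closedBall p (2δ) ⊆ U`, then `w = 0` on `ball p (stepRadius ρ δ)`. (Carleman's method with the
weight `(κ + ‖z - b‖²)⁻¹` centred at the interior point `b` at distance `σ = min ρ (δ/8)` from
`p`, `κ = σ²/2`, and a cut-off equal to `1` on `ball p δ`.) [folklore] -/
theorem local_step (hJ : ∀ v, J (J v) = -v) {U : Set ℂ} (hU : IsOpen U) {w : ℂ → V}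
    (hw : ContDiffOn ℝ 2 w U) {M : ℝ} (hM : ∀ z ∈ U, ‖Dop J w z‖ ≤ M * ‖w z‖) {z' : ℂ}
    {ρ δ : ℝ} (hρ : 0 < ρ) (hδ : 0 < δ) (h0 : ∀ z ∈ ball z' ρ, w z = 0) {p : ℂ}
    (hp : dist p z' = ρ) (hpU : closedBall p (2 * δ) ⊆ U) :
    ∀ z ∈ ball p (stepRadius ρ δ), w z = 0 := by
  -- parameters
  set σ : ℝ := min ρ (δ / 8) with hσ_def
  have hσρ : σ ≤ ρ := min_le_left _ _
  have hσδ : σ ≤ δ / 8 := min_le_right _ _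
  have hσ0 : 0 < σ := lt_min hρ (by linarith)
  set κ : ℝ := σ ^ 2 / 2 with hκ_def
  have hκ0 : 0 < κ := by positivity
  set R : ℝ := Real.sqrt (σ ^ 2 + δ ^ 2 / 4) with hR_def
  have hR0 : 0 ≤ R := Real.sqrt_nonneg _
  have hR2 : R ^ 2 = σ ^ 2 + δ ^ 2 / 4 := Real.sq_sqrt (by positivity)
  have hσR : σ < R := by nlinarith
  have hRδ : R ≤ δ - σ := by nlinarith
  have hstep : stepRadius ρ δ = R - σ := rfl
  -- the centre of the weight
  set b : ℂ := p + ((σ / ρ : ℝ) : ℂ) * (z' - p) with hb_def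
  have hpz' : ‖p - z'‖ = ρ := by rw [← dist_eq_norm]; exact hp
  have hpb : ‖p - b‖ = σ := by
    have : p - b = -(((σ / ρ : ℝ) : ℂ) * (z' - p)) := by rw [hb_def]; ring
    rw [this, norm_neg, norm_mul, Complex.norm_real, Real.norm_eq_abs,
      abs_of_pos (div_pos hσ0 hρ), norm_sub_rev, hpz']
    field_simp
  have hbz' : ‖b - z'‖ = ρ - σ := by
    have : b - z' = ((1 - σ / ρ : ℝ) : ℂ) * (p - z') := by
      rw [hb_def]; push_cast; ring
    rw [this, norm_mul, Complex.norm_real, Real.norm_eq_abs, hpz',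
      abs_of_nonneg (by rw [sub_nonneg, div_le_one hρ]; exact hσρ)]
    field_simp
  -- the cut-off and the localised function
  let χ : ContDiffBump p := ⟨δ, 2 * δ, hδ, by linarith⟩
  have hχU : tsupport (χ : ℂ → ℝ) ⊆ U := by rw [χ.tsupport_eq]; exact hpU
  have hχs : ContDiff ℝ 2 (χ : ℂ → ℝ) := χ.contDiff
  have hχd : Differentiable ℝ (χ : ℂ → ℝ) := hχs.differentiable (by norm_num)
  set f : ℂ → V := fun y => χ y • w y with hf_def
  have hf2 : ContDiff ℝ 2 f := contDiff_smul_of_tsupport_subset hU hχs hχU hw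
  have hK : IsCompact (closedBall p (2 * δ)) := isCompact_closedBall _ _
  have hχ0 : ∀ y, y ∉ closedBall p (2 * δ) → χ y = 0 := fun y hy =>
    image_eq_zero_of_notMem_tsupport (by rwa [χ.tsupport_eq])
  have hfc : HasCompactSupport f := HasCompactSupport.intro hK fun y hy => by
    simp [hf_def, hχ0 y hy]
  -- the weight
  have hφ : ContDiff ℝ 2 (weight b κ) := contDiff_weight b hκ0
  -- the error term
  set e : ℂ → V := fun y => dX (χ : ℂ → ℝ) y • w y + dY (χ : ℂ → ℝ) y • J (w y) with he_def
  have hwc : ContinuousOn w U := hw.continuousOn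
  have hec : Continuous e := by
    refine (continuous_smul_of_tsupport_subset hU (continuous_dX hχs)
      ((tsupport_dX_subset _).trans hχU) hwc).add
      (continuous_smul_of_tsupport_subset hU (continuous_dY hχs)
        ((tsupport_dY_subset _).trans hχU) (J.continuous.comp_continuousOn hwc))
  have hdχ0 : ∀ y, y ∉ closedBall p (2 * δ) → fderiv ℝ (χ : ℂ → ℝ) y = 0 := fun y hy =>
    fderiv_of_notMem_tsupport ℝ (by rwa [χ.tsupport_eq])
  set E : ℂ → ℝ := fun y => 2 * (1 + ‖J‖ ^ 2) * ‖e y‖ ^ 2 with hE_def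
  have hEc : Continuous E := continuous_const.mul (hec.norm.pow 2)
  have hEs : HasCompactSupport E := HasCompactSupport.intro hK fun y hy => by
    simp [hE_def, he_def, dX, dY, hdχ0 y hy]
  have hE0 : ∀ y, 0 ≤ E y := fun y => by positivity
  -- the Leibniz rule: `D f = χ D w + e`
  have hwd : DifferentiableOn ℝ w U := hw.differentiableOn (by norm_num)
  have hDf : ∀ y, Dop J f y = χ y • Dop J w y + e y := by
    intro y
    simp only [Dop, dX, dY, he_def, hf_def,
      fderiv_smul_apply_of_tsupport_subset hU hχd hχU hwd, map_add, map_smul, smul_add]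
    abel
  -- the differential inequality for `f`
  have hineq : ∀ y, Nf J (Dop J f y) ≤ 2 * (1 + ‖J‖ ^ 2) * M ^ 2 * ‖f y‖ ^ 2 + E y := by
    intro y
    have h1 : ‖χ y • Dop J w y‖ ≤ M * ‖f y‖ := by
      by_cases hy : y ∈ U
      · rw [hf_def, norm_smul, norm_smul, mul_left_comm]
        exact mul_le_mul_of_nonneg_left (hM y hy) (norm_nonneg _)
      · have : χ y = 0 := image_eq_zero_of_notMem_tsupport fun h => hy (hχU h)
        simp [this, hf_def]
    have h2 : ‖Dop J f y‖ ≤ M * ‖f y‖ + ‖e y‖ := by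
      rw [hDf y]; exact (norm_add_le _ _).trans (by linarith)
    have := Nf_le_of_norm_le J h2
    simpa [hE_def] using this
  -- where `f ≠ 0`: the annulus `σ ≤ ‖y - b‖ ≤ 2δ + σ`, on which `Δφ ≥ μ`
  have hsupp : ∀ y, f y ≠ 0 → σ ≤ ‖y - b‖ ∧ ‖y - b‖ ≤ 2 * δ + σ := by
    intro y hy
    have hχy : χ y ≠ 0 := fun h => hy (by simp [hf_def, h])
    have hwy : w y ≠ 0 := fun h => hy (by simp [hf_def, h])
    have hy1 : dist y p < 2 * δ := by
      have : y ∈ Function.support (χ : ℂ → ℝ) := hχy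
      rw [χ.support_eq] at this
      simpa using this
    have hy2 : ρ ≤ dist y z' := by
      by_contra h
      push Not at h
      exact hwy (h0 y h)
    constructor
    · have := norm_sub_le_norm_sub_add_norm_sub y b z'
      -- ‖y - z'‖ ≤ ‖y - b‖ + ‖b - z'‖
      rw [dist_eq_norm] at hy2
      linarith [norm_sub_le_norm_sub_add_norm_sub y b z']
    · rw [dist_eq_norm] at hy1
      linarith [norm_sub_le_norm_sub_add_norm_sub y p b]
  set μ : ℝ := 2 * κ / (κ + (2 * δ + σ) ^ 2) ^ 3 with hμ_def
  have hμ0 : 0 < μ := by positivity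
  have hlap : ∀ y, f y ≠ 0 → μ ≤ lap (weight b κ) y := by
    intro y hy
    obtain ⟨h1, h2⟩ := hsupp y hy
    exact lap_weight_ge b hκ0 (by rw [hκ_def]; linarith) h1 h2 hσ0.le
  -- where `E ≠ 0`: `δ - σ ≤ ‖y - b‖`, hence `φ y ≤ l`
  set l : ℝ := (κ + R ^ 2)⁻¹ with hl_def
  have hEl : ∀ y, E y ≠ 0 → weight b κ y ≤ l := by
    intro y hy
    have hey : e y ≠ 0 := fun h => hy (by simp [hE_def, h])
    have hdy : fderiv ℝ (χ : ℂ → ℝ) y ≠ 0 := by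
      intro h
      exact hey (by simp [he_def, dX, dY, h])
    have hy1 := (bump_rIn_le_dist_of_fderiv_ne_zero χ hdy).1
    change δ ≤ dist y p at hy1
    rw [dist_eq_norm] at hy1
    have hyb : δ - σ ≤ ‖y - b‖ := by
      linarith [norm_sub_le_norm_sub_add_norm_sub y b p, hpb.symm ▸ norm_sub_rev p b]
    exact weight_le_of_le_norm b hκ0 hR0 (hRδ.trans hyb)
  -- Carleman ⇒ `f = 0` on `{φ > l} = ball b R`
  have hmain := eq_zero_of_carleman hJ hφ hf2 hfc hEc hEs hE0 (by positivity) hμ0 hlap hineq hEl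
  -- conclusion on `ball p (R - σ)`
  intro z hz
  rw [hstep, mem_ball, dist_eq_norm] at hz
  have hzb : ‖z - b‖ < R := by linarith [norm_sub_le_norm_sub_add_norm_sub z p b, hpb]
  have hφz : l < weight b κ z := (weight_lt_weight_iff b hκ0 hR0).mpr hzb
  have hfz : f z = 0 := hmain z hφz
  have hχz : χ z = 1 := χ.one_of_mem_closedBall (by
    change dist z p ≤ δ
    rw [dist_eq_norm]; linarith)
  simpa [hf_def, hχz] using hfz

end LocalStep

/-! ### Propagation over a disc -/

section Propagation

variable {J : V →L[ℝ] V}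

/-- Zeros on `ball z' ρ` spread to `ball z' (ρ + stepRadius ρ δ)` when
`closedBall z' (ρ + 2δ) ⊆ U` (the local step at the radial projection). [folklore] -/
theorem spread_step (hJ : ∀ v, J (J v) = -v) {U : Set ℂ} (hU : IsOpen U) {w : ℂ → V}
    (hw : ContDiffOn ℝ 2 w U) {M : ℝ} (hM : ∀ z ∈ U, ‖Dop J w z‖ ≤ M * ‖w z‖) {z' : ℂ}
    {ρ δ : ℝ} (hρ : 0 < ρ) (hδ : 0 < δ) (h0 : ∀ z ∈ ball z' ρ, w z = 0)
    (hU' : closedBall z' (ρ + 2 * δ) ⊆ U) :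
    ∀ z ∈ ball z' (ρ + stepRadius ρ δ), w z = 0 := by
  intro z hz
  by_cases hzρ : dist z z' < ρ
  · exact h0 z hzρ
  push Not at hzρ
  set d : ℝ := dist z z' with hd_def
  have hd0 : 0 < d := lt_of_lt_of_le hρ hzρ
  set t : ℝ := ρ / d with ht_def
  have ht0 : 0 < t := div_pos hρ hd0
  have ht1 : t ≤ 1 := (div_le_one hd0).mpr hzρ
  set p : ℂ := z' + (t : ℂ) * (z - z') with hp_def
  have hdn : ‖z - z'‖ = d := by rw [hd_def, dist_eq_norm]
  have hp : dist p z' = ρ := by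
    rw [dist_eq_norm, hp_def, add_sub_cancel_left, norm_mul, Complex.norm_real, Real.norm_eq_abs,
      abs_of_pos ht0, hdn, ht_def, div_mul_cancel₀ _ hd0.ne']
  have hpU : closedBall p (2 * δ) ⊆ U := by
    refine subset_trans (closedBall_subset_closedBall' ?_) hU'
    rw [hp]; linarith
  have hzp : z ∈ ball p (stepRadius ρ δ) := by
    rw [mem_ball, dist_eq_norm]
    have : z - p = ((1 - t : ℝ) : ℂ) * (z - z') := by rw [hp_def]; push_cast; ring
    rw [this, norm_mul, Complex.norm_real, Real.norm_eq_abs, abs_of_nonneg (by linarith), hdn,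
      sub_mul, one_mul, ht_def, div_mul_cancel₀ _ hd0.ne']
    have : d < ρ + stepRadius ρ δ := hz
    linarith
  exact local_step hJ hU hw hM hρ hδ h0 hp hpU z hzp

/-- **Radial propagation.** If `w = 0` near `z'` and `closedBall z' R₀ ⊆ U`, then `w = 0` on
`ball z' R₀` (continuity argument on the radius, using `spread_step`). [folklore] -/
theorem radial_propagation (hJ : ∀ v, J (J v) = -v) {U : Set ℂ} (hU : IsOpen U) {w : ℂ → V}
    (hw : ContDiffOn ℝ 2 w U) {M : ℝ} (hM : ∀ z ∈ U, ‖Dop J w z‖ ≤ M * ‖w z‖) {z' : ℂ}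
    {ρ₀ R₀ : ℝ} (hρ₀ : 0 < ρ₀) (h0 : ∀ z ∈ ball z' ρ₀, w z = 0) (hR : closedBall z' R₀ ⊆ U) :
    ∀ z ∈ ball z' R₀, w z = 0 := by
  by_contra hcon
  push Not at hcon
  obtain ⟨z₁, hz₁, hwz₁⟩ := hcon
  have hR₀ : 0 < R₀ := lt_of_le_of_lt dist_nonneg (mem_ball.mp hz₁)
  set S : Set ℝ := {ρ | ρ ≤ R₀ ∧ ∀ z ∈ ball z' ρ, w z = 0} with hS_def
  have hS0 : min ρ₀ R₀ ∈ S :=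
    ⟨min_le_right _ _, fun z hz => h0 z (ball_subset_ball (min_le_left _ _) hz)⟩
  have hne : S.Nonempty := ⟨_, hS0⟩
  have hbdd : BddAbove S := ⟨R₀, fun ρ h => h.1⟩
  set ρs : ℝ := sSup S with hρs_def
  have hρs_le : ρs ≤ R₀ := csSup_le hne fun ρ h => h.1
  have hρs_ge : min ρ₀ R₀ ≤ ρs := le_csSup hbdd hS0
  have hρs0 : 0 < ρs := lt_of_lt_of_le (lt_min hρ₀ hR₀) hρs_ge
  have hzero : ∀ z ∈ ball z' ρs, w z = 0 := by
    intro z hz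
    obtain ⟨ρ, hρS, hlt⟩ := exists_lt_of_lt_csSup hne (mem_ball.mp hz)
    exact hρS.2 z (mem_ball.mpr hlt)
  have hlt : ρs < R₀ := by
    refine lt_of_le_of_ne hρs_le fun h => hwz₁ (hzero z₁ ?_)
    rw [h]; exact hz₁
  set δ : ℝ := (R₀ - ρs) / 2 with hδ_def
  have hδ : 0 < δ := by rw [hδ_def]; linarith
  have hsp := spread_step hJ hU hw hM hρs0 hδ hzero (by
    have : ρs + 2 * δ = R₀ := by rw [hδ_def]; ring
    rw [this]; exact hR)
  have hpos := stepRadius_pos hρs0 hδ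
  have hmem : min (ρs + stepRadius ρs δ) R₀ ∈ S :=
    ⟨min_le_right _ _, fun z hz => hsp z (ball_subset_ball (min_le_left _ _) hz)⟩
  have := le_csSup hbdd hmem
  have h2 : ρs < min (ρs + stepRadius ρs δ) R₀ := lt_min (by linarith) hlt
  linarith

/-- **Weak unique continuation on a disc** for `C²` solutions of `‖∂ₓw + J∂ᵧw‖ ≤ M ‖w‖`:
if `w` vanishes near one point of the disc, it vanishes on the disc. [folklore] -/
theorem eq_zero_on_ball (hJ : ∀ v, J (J v) = -v) {c : ℂ} {r : ℝ} {w : ℂ → V}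
    (hw : ContDiffOn ℝ 2 w (ball c r)) {M : ℝ}
    (hM : ∀ z ∈ ball c r, ‖Dop J w z‖ ≤ M * ‖w z‖) {z₀ : ℂ} (hz₀ : z₀ ∈ ball c r)
    (h0 : ∀ᶠ z in 𝓝 z₀, w z = 0) : ∀ z ∈ ball c r, w z = 0 := by
  set A : Set ℂ := {z | ∀ᶠ y in 𝓝 z, w y = 0} with hA_def
  have hA : IsOpen A := isOpen_setOf_eventually_nhds
  have key : ball c r ⊆ A := by
    refine (convex_ball c r).isPreconnected.subset_of_closure_inter_subset hA ⟨z₀, hz₀, h0⟩ ?_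
    rintro z₁ ⟨hz₁c, hz₁⟩
    set δ : ℝ := (r - dist z₁ c) / 4 with hδ_def
    have hδ : 0 < δ := by
      have : dist z₁ c < r := mem_ball.mp hz₁
      rw [hδ_def]; linarith
    obtain ⟨z', hz'A, hz'd⟩ := Metric.mem_closure_iff.mp hz₁c δ hδ
    obtain ⟨ε, hε, hball⟩ := eventually_nhds_iff_ball.mp hz'A
    have hsub : closedBall z' (2 * δ) ⊆ ball c r := by
      intro y hy
      rw [mem_closedBall] at hy
      rw [mem_ball]
      have h1 := dist_triangle y z' c
      have h2 := dist_triangle z' z₁ c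
      rw [dist_comm z' z₁] at h2
      have h3 : 4 * δ = r - dist z₁ c := by rw [hδ_def]; ring
      linarith
    have hprop := radial_propagation hJ isOpen_ball hw hM hε hball hsub
    have hz₁' : z₁ ∈ ball z' (2 * δ) := by
      rw [mem_ball]; linarith [dist_comm z₁ z']
    exact Filter.eventually_of_mem (isOpen_ball.mem_nhds hz₁') hprop
  intro z hz
  exact (key hz).self_of_nhds

end Propagation

end FlatUniqueContinuation

/-! ### The discharge -/

open FlatUniqueContinuation in
/-- A `C¹` map is Lipschitz *relative to a fixed point* `p₀` on any compact subset of its open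
domain: `‖F q - F p₀‖ ≤ L ‖q - p₀‖` (local Lipschitz near `p₀`, boundedness away from it).
[folklore] -/
theorem exists_norm_sub_le_mul_of_contDiffOn {E F : Type*} [NormedAddCommGroup E]
    [NormedSpace ℝ E] [NormedAddCommGroup F] [NormedSpace ℝ F] {G : E → F} {T K : Set E}
    (hT : IsOpen T) (hG : ContDiffOn ℝ 1 G T) (hK : IsCompact K) (hKT : K ⊆ T) {p₀ : E}
    (hp₀ : p₀ ∈ K) : ∃ L : ℝ, 0 ≤ L ∧ ∀ q ∈ K, ‖G q - G p₀‖ ≤ L * ‖q - p₀‖ := by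
  have hp₀T : p₀ ∈ T := hKT hp₀
  obtain ⟨L₀, t, ht, hLip⟩ := (hG.contDiffAt (hT.mem_nhds hp₀T)).exists_lipschitzOnWith
  obtain ⟨ε, hε, hεt⟩ := Metric.mem_nhds_iff.mp ht
  obtain ⟨C, hC⟩ := hK.exists_bound_of_continuousOn (hG.continuousOn.mono hKT)
  have hC0 : 0 ≤ C := le_trans (norm_nonneg _) (hC p₀ hp₀)
  refine ⟨max L₀ (2 * C / ε), le_max_of_le_left L₀.2, fun q hq => ?_⟩
  by_cases hqε : dist q p₀ < ε
  · have h1 := hLip.dist_le_mul q (hεt hqε) p₀ (hεt (mem_ball_self hε))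
    rw [dist_eq_norm, dist_eq_norm] at h1
    exact h1.trans (mul_le_mul_of_nonneg_right (le_max_left _ _) (norm_nonneg _))
  · push Not at hqε
    rw [dist_eq_norm] at hqε
    have h1 : ‖G q - G p₀‖ ≤ 2 * C := by
      have := norm_sub_le (G q) (G p₀)
      linarith [hC q hq, hC p₀ hp₀]
    have h2 : 2 * C ≤ 2 * C / ε * ‖q - p₀‖ := by
      rw [div_mul_eq_mul_div, le_div_iff₀ hε]
      exact mul_le_mul_of_nonneg_left hqε (by linarith)
    exact h1.trans (h2.trans (mul_le_mul_of_nonneg_right (le_max_right _ _) (norm_nonneg _)))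

open FlatUniqueContinuation in
/-- **Discharge of `jHolomorphicFlat_uniqueContinuation_const`** (McDuff 1991, Lemma 2.3, via
Carleman's method). In coordinates `w = u - u z₀` solves `∂ₓw + J∂ᵧw = J (Jc(u) - J) ∂ₓu` with
`J = Jc (u z₀)`, hence `‖∂ₓw + J∂ᵧw‖ ≤ M ‖w‖` on every smaller disc; the weak unique
continuation theorem `FlatUniqueContinuation.eq_zero_on_ball` (Carleman estimate for `∂ₓ + J∂ᵧ`
with the weight `(κ + ‖z - b‖²)⁻¹`) concludes.
[cite: McDuff1991LocalBehaviour, Lemma 2.3 and (2.3.1)] -/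
theorem jHolomorphicFlat_uniqueContinuation_const_holds :
    jHolomorphicFlat_uniqueContinuation_const := by
  intro T hT Jc hJc hJ2 c r hr u hu huT hhol z₀ hz₀ hconst z hz
  -- a smaller closed disc containing `z` and `z₀`
  obtain ⟨r', hr'1, hr'2⟩ := exists_between (max_lt (mem_ball.mp hz) (mem_ball.mp hz₀))
  have hzr' : dist z c < r' := lt_of_le_of_lt (le_max_left _ _) hr'1
  have hz₀r' : dist z₀ c < r' := lt_of_le_of_lt (le_max_right _ _) hr'1
  set p₀ := u z₀ with hp₀_def
  have hp₀T : p₀ ∈ T := huT hz₀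
  set J : EuclideanSpace ℝ (Fin 4) →L[ℝ] EuclideanSpace ℝ (Fin 4) := Jc p₀ with hJ_def
  have hJ : ∀ v, J (J v) = -v := hJ2 p₀ hp₀T
  set w : ℂ → EuclideanSpace ℝ (Fin 4) := fun y => u y - p₀ with hw_def
  -- compact sets
  set K : Set ℂ := closedBall c r' with hK_def
  have hK : IsCompact K := isCompact_closedBall _ _
  have hKB : K ⊆ ball c r := closedBall_subset_ball hr'2
  have huc : ContinuousOn u (ball c r) := hu.continuousOn
  have hK' : IsCompact (u '' K) := hK.image_of_continuousOn (huc.mono hKB)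
  have hK'T : u '' K ⊆ T := by
    rintro _ ⟨y, hy, rfl⟩; exact huT (hKB hy)
  have hz₀K : z₀ ∈ K := mem_closedBall.mpr hz₀r'.le
  -- the Lipschitz-type constant for `Jc` relative to `p₀`
  obtain ⟨L, hL0, hL⟩ := exists_norm_sub_le_mul_of_contDiffOn hT (hJc.of_le (by norm_num)) hK'
    hK'T (mem_image_of_mem u hz₀K)
  -- a bound for `∂ₓ u` on `K`
  have hfd : ContinuousOn (fderiv ℝ u) (ball c r) :=
    hu.continuousOn_fderiv_of_isOpen isOpen_ball (by norm_num)
  obtain ⟨A, hA⟩ := hK.exists_bound_of_continuousOn (hfd.mono hKB)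
  have hA0 : 0 ≤ A := le_trans (norm_nonneg _) (hA z₀ hz₀K)
  -- the differential inequality on `ball c r'`
  set M : ℝ := ‖J‖ * L * A with hM_def
  have hM : ∀ y ∈ ball c r', ‖Dop J w y‖ ≤ M * ‖w y‖ := by
    intro y hy
    have hyK : y ∈ K := ball_subset_closedBall hy
    have hyB : y ∈ ball c r := hKB hyK
    have hdiff : DifferentiableAt ℝ u y :=
      (hu.differentiableOn (by norm_num)).differentiableAt (isOpen_ball.mem_nhds hyB)
    have e1 : fderiv ℝ w y = fderiv ℝ u y := by
      rw [hw_def]; exact fderiv_sub_const _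
    have e2 : dY u y = Jc (u y) (dX u y) := by
      have := hhol y hyB 1
      rw [mul_one] at this
      exact this
    have e3 : Dop J w y = J ((Jc (u y) - J) (dX u y)) := by
      simp only [Dop, dX, dY, e1] at e2 ⊢
      rw [e2]
      simp only [sub_apply, map_sub, hJ]
      abel
    rw [e3]
    have h1 : ‖dX u y‖ ≤ A := by
      have := (fderiv ℝ u y).le_opNorm (1 : ℂ)
      rw [norm_one, mul_one] at this
      exact this.trans (hA y hyK)
    have h2 : ‖Jc (u y) - J‖ ≤ L * ‖w y‖ := hL (u y) (mem_image_of_mem u hyK)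
    calc ‖J ((Jc (u y) - J) (dX u y))‖ ≤ ‖J‖ * ‖(Jc (u y) - J) (dX u y)‖ := J.le_opNorm _
      _ ≤ ‖J‖ * (‖Jc (u y) - J‖ * ‖dX u y‖) :=
          mul_le_mul_of_nonneg_left ((Jc (u y) - J).le_opNorm _) (norm_nonneg _)
      _ ≤ ‖J‖ * (L * ‖w y‖ * A) := by
          refine mul_le_mul_of_nonneg_left ?_ (norm_nonneg _)
          exact mul_le_mul h2 h1 (norm_nonneg _) (mul_nonneg hL0 (norm_nonneg _))
      _ = M * ‖w y‖ := by rw [hM_def]; ring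
  -- regularity of `w` and vanishing near `z₀`
  have hw2 : ContDiffOn ℝ 2 w (ball c r') :=
    ((hu.sub contDiffOn_const).of_le (by norm_cast)).mono (ball_subset_ball hr'2.le)
  have h0 : ∀ᶠ y in 𝓝 z₀, w y = 0 := by
    filter_upwards [hconst] with y hy
    simp [hw_def, hy, hp₀_def]
  have := eq_zero_on_ball hJ hw2 hM (mem_ball.mpr hz₀r') h0 z (mem_ball.mpr hzr')
  simpa [hw_def, sub_eq_zero] using this

end Literature.Geometry.Symplectic
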